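import Literature.Probability.Distributions.WeakConvergenceCoupling
import HarnessLib

/-!
# Lifting a coupling along a finitely-valued random variable

Topic `Literature/Probability/Distributions` (general measure theory; everything is proved, no
named fact is introduced). Companion to `WeakConvergenceCoupling.lean`. Coupling distances
between *laws presented on base probability spaces* — DKKMO's `d_CN` in the tree's rendering,
`Literature.Probability.RandomPlanarGeometry.LoopConfig.cnLawEDist μ X μ' X'`, asks for measures on
`Ω × Ω'` with marginals `μ`, `μ'` — are fed by couplings of the *image* laws (e.g. the couplings
of `WeakConvergenceCoupling.exists_coupling_of_tendsto_of_isCompact` on the loop space), which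
must then be lifted back to the base spaces. Along an arbitrary measurable map this needs a
disintegration and a measurable graph (standard Borel hypotheses, cf. the gluing lemma
`LoopConfig.exists_glued_coupling`); along a **finitely-valued** map — every lattice observable at
a fixed mesh in a bounded window, such as the loop collection `triLoopCollection D δ` or the typed
configuration of the sites in a disc — it is elementary, and this file does it:

* `liftCoupling μ f F π` — for `f : Ω → S` with values in the finite set `F` and a coupling `π`
  on `S × S'` with first marginal the law of `f`: the mixture over `v ∈ F` of
  `μ(· | f = v) ⊗ π|_{\{v\} × S'}(S × ·)` (draw `(s, s')` from `π`, then `a` from `μ`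
  conditioned on `f(a) = s`, independently of `s'`).
* `map_fst_liftCoupling`, `map_snd_liftCoupling` — its marginals are `μ` and the second marginal
  of `π` (the fibres `f⁻¹{v}`, `v ∈ F`, partition `Ω`; `π` gives no mass off `F × S'`);
  `liftCoupling_apply_preimage` — **`(f(a), s')` has the law `π` under the lift**:
  `liftCoupling … {(a, s') | (f a, s') ∈ E} = π(E)` for every measurable `E` (each term sees
  only its fibre, where the section of the event is the slice `E_v`).
* `exists_coupling_lift_of_finite_range` — the packaged statement for a measurable `f` with
  finite range (singletons of `S` measurable).

## References

* C. Villani, *Optimal Transport, Old and New*, Springer (2009), Ch. 1 (couplings; gluing).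
* T. Lindvall, *Lectures on the Coupling Method*, Wiley (1992), §I.5.
-/

noncomputable section

open MeasureTheory Set Function
open scoped ENNReal

namespace Literature.Probability.Distributions

variable {Ω S S' : Type*} [MeasurableSpace Ω] [MeasurableSpace S] [MeasurableSpace S']

/-- **The lift of a coupling along a finitely-valued map.** Given a law `μ` on `Ω`, a map
`f : Ω → S` with values in the finite set `F`, and a coupling `π` on `S × S'` whose first marginal
is the law of `f`, the measure on `Ω × S'` obtained by drawing `(s, s')` from `π` and then `a`
from `μ` conditioned on `f = s`, independently of `s'`:
`Σ_{v ∈ F} μ(· | f = v) ⊗ π|_{\{v\} × S'}(S × ·)`. [folklore] -/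
def liftCoupling (μ : Measure Ω) (f : Ω → S) (F : Finset S) (π : Measure (S × S')) : Measure (Ω × S') :=
  ∑ v ∈ F, ((μ (f ⁻¹' {v}))⁻¹ • μ.restrict (f ⁻¹' {v})).prod (π.restrict ({v} ×ˢ univ)).snd

section

variable [MeasurableSingletonClass S] {μ : Measure Ω} [IsProbabilityMeasure μ] {f : Ω → S}
  (hf : Measurable f) {F : Finset S} (hF : ∀ a, f a ∈ F) {π : Measure (S × S')} [IsProbabilityMeasure π]
  (h1 : π.map Prod.fst = μ.map f)

omit [IsProbabilityMeasure μ] [IsProbabilityMeasure π] in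
include hf h1 in
/-- The coupling gives the fibre `{v} × S'` the mass `μ(f = v)`. [folklore] -/
theorem measure_singleton_prod_univ (v : S) : π ({v} ×ˢ univ) = μ (f ⁻¹' {v}) := by
  rw [show ({v} ×ˢ univ : Set (S × S')) = Prod.fst ⁻¹' {v} by ext p; simp,
    ← Measure.map_apply measurable_fst (measurableSet_singleton v), h1,
    Measure.map_apply hf (measurableSet_singleton v)]

omit [MeasurableSingletonClass S] [IsProbabilityMeasure π] in
/-- The slice measures: `π|_{\{v\} × S'}(S × B) = π({v} × B)`. [folklore] -/
theorem snd_restrict_singleton_prod_apply (v : S) {B : Set S'} (hB : MeasurableSet B) :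
    (π.restrict ({v} ×ˢ univ)).snd B = π ({v} ×ˢ B) := by
  rw [Measure.snd_apply hB, Measure.restrict_apply (measurable_snd hB)]
  congr 1
  ext p
  simp only [mem_inter_iff, mem_preimage, mem_prod, mem_singleton_iff, mem_univ, and_true]
  tauto

omit [IsProbabilityMeasure μ] [IsProbabilityMeasure π] in
include hf h1 in
/-- The slice measure of `v` has mass `μ(f = v)`. [folklore] -/
theorem snd_restrict_singleton_prod_univ (v : S) : (π.restrict ({v} ×ˢ univ)).snd univ = μ (f ⁻¹' {v}) := by
  rw [Measure.snd_univ, Measure.restrict_apply_univ, measure_singleton_prod_univ hf h1]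

include hf hF h1 in
/-- **First marginal of the lift is `μ`.** [folklore] -/
theorem map_fst_liftCoupling : (liftCoupling μ f F π).map Prod.fst = μ := by
  rw [liftCoupling, map_finsetSum _ _ measurable_fst]
  simp only [Measure.map_fst_prod, snd_restrict_singleton_prod_univ hf h1, smul_smul]
  have hterm : ∀ v ∈ F, (μ (f ⁻¹' {v}) * (μ (f ⁻¹' {v}))⁻¹) • μ.restrict (f ⁻¹' {v}) = μ.restrict (f ⁻¹' {v}) := by
    intro v _
    rcases eq_or_ne (μ (f ⁻¹' {v})) 0 with h0 | h0
    · rw [Measure.restrict_eq_zero.2 h0, smul_zero]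
    · rw [ENNReal.mul_inv_cancel h0 (measure_ne_top _ _), one_smul]
  rw [Finset.sum_congr rfl hterm]
  -- `Σ_{v ∈ F} μ|_{f = v} = μ` (the fibres over `F` partition `Ω`)
  have hdisj : Pairwise (Disjoint on fun v : ↥F ↦ f ⁻¹' {(v : S)}) := fun v v' hne ↦
    disjoint_left.2 fun a (ha : f a = v) (ha' : f a = v') ↦ hne (Subtype.ext (ha.symm.trans ha'))
  have hU : ⋃ v : ↥F, f ⁻¹' {(v : S)} = univ := eq_univ_of_forall fun a ↦ mem_iUnion.2 ⟨⟨f a, hF a⟩, rfl⟩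
  rw [← Finset.sum_coe_sort, ← Measure.sum_fintype,
    ← Measure.restrict_iUnion hdisj (fun v ↦ hf (measurableSet_singleton _)), hU, Measure.restrict_univ]

include hf hF h1 in
/-- **Second marginal of the lift is the second marginal of `π`.** [folklore] -/
theorem map_snd_liftCoupling : (liftCoupling μ f F π).map Prod.snd = π.map Prod.snd := by
  rw [liftCoupling, map_finsetSum _ _ measurable_snd]
  simp only [Measure.map_snd_prod, Measure.smul_apply, Measure.restrict_apply_univ, smul_eq_mul]
  have hterm : ∀ v ∈ F, ((μ (f ⁻¹' {v}))⁻¹ * μ (f ⁻¹' {v})) • (π.restrict ({v} ×ˢ univ)).snd =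
      (π.restrict ({v} ×ˢ univ)).snd := by
    intro v _
    rcases eq_or_ne (μ (f ⁻¹' {v})) 0 with h0 | h0
    · have hz : (π.restrict ({v} ×ˢ univ)).snd = 0 := by
        rw [← Measure.measure_univ_eq_zero, snd_restrict_singleton_prod_univ hf h1, h0]
      rw [hz, smul_zero]
    · rw [ENNReal.inv_mul_cancel h0 (measure_ne_top _ _), one_smul]
  rw [Finset.sum_congr rfl hterm]
  ext B hB
  rw [Measure.finsetSum_apply, Measure.map_apply measurable_snd hB,
    Finset.sum_congr rfl fun v _ ↦ snd_restrict_singleton_prod_apply (π := π) v hB]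
  -- `Σ_{v ∈ F} π({v} × B) = π(F × B) = π(S × B)`
  have hdisj : PairwiseDisjoint (↑F : Set S) fun v ↦ ({v} ×ˢ B : Set (S × S')) := fun v _ v' _ hne ↦
    disjoint_left.2 fun p hp hp' ↦ hne ((mem_prod.1 hp).1.symm.trans (mem_prod.1 hp').1)
  rw [← measure_biUnion_finset hdisj fun v _ ↦ (measurableSet_singleton v).prod hB]
  have hFc : π ((↑F : Set S)ᶜ ×ˢ (univ : Set S')) = 0 := by
    rw [show ((↑F : Set S)ᶜ ×ˢ univ : Set (S × S')) = Prod.fst ⁻¹' (↑F : Set S)ᶜ by ext p; simp,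
      ← Measure.map_apply measurable_fst F.measurableSet.compl, h1, Measure.map_apply hf F.measurableSet.compl]
    convert measure_empty (μ := μ)
    exact eq_empty_of_forall_notMem fun a ha ↦ ha (hF a)
  refine le_antisymm (measure_mono ?_) ?_
  · exact iUnion₂_subset fun v _ p hp ↦ (mem_prod.1 hp).2
  · calc π (Prod.snd ⁻¹' B) ≤ π ((⋃ v ∈ F, {v} ×ˢ B) ∪ (↑F : Set S)ᶜ ×ˢ univ) := measure_mono fun p hp ↦ ?_
      _ ≤ π (⋃ v ∈ F, {v} ×ˢ B) + π ((↑F : Set S)ᶜ ×ˢ univ) := measure_union_le _ _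
      _ = π (⋃ v ∈ F, {v} ×ˢ B) := by rw [hFc, add_zero]
    by_cases h : p.1 ∈ F
    · exact Or.inl (mem_iUnion₂.2 ⟨p.1, h, mem_prod.2 ⟨rfl, hp⟩⟩)
    · exact Or.inr (mem_prod.2 ⟨h, mem_univ _⟩)

include hf hF h1 in
/-- The lift is a probability measure. [folklore] -/
theorem isProbabilityMeasure_liftCoupling : IsProbabilityMeasure (liftCoupling μ f F π) := by
  refine ⟨?_⟩
  have h := congrArg (fun m : Measure Ω ↦ m univ) (map_fst_liftCoupling hf hF h1)
  simp only [Measure.map_apply measurable_fst MeasurableSet.univ, preimage_univ, measure_univ] at h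
  exact h

include hf hF h1 in
/-- **The lift reproduces every event of the coupling**: the pair `(f(a), s')` under the lift has
the law `π`. [folklore] -/
theorem liftCoupling_apply_preimage {E : Set (S × S')} (hE : MeasurableSet E) :
    liftCoupling μ f F π {p | (f p.1, p.2) ∈ E} = π E := by
  have hG : MeasurableSet {p : Ω × S' | (f p.1, p.2) ∈ E} :=
    (hf.comp measurable_fst).prodMk measurable_snd hE
  rw [liftCoupling, Measure.finsetSum_apply]
  -- each term sees only its fibre, where the section of the event is the slice `E_v`
  have hterm : ∀ v ∈ F, (((μ (f ⁻¹' {v}))⁻¹ • μ.restrict (f ⁻¹' {v})).prod (π.restrict ({v} ×ˢ univ)).snd)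
      {p : Ω × S' | (f p.1, p.2) ∈ E} = π ({v} ×ˢ (Prod.mk v ⁻¹' E)) := by
    intro v _
    set μ' : Measure Ω := (μ (f ⁻¹' {v}))⁻¹ • μ.restrict (f ⁻¹' {v}) with hμ'
    set σ : Measure S' := (π.restrict ({v} ×ˢ univ)).snd with hσ
    have hEv : MeasurableSet (Prod.mk v ⁻¹' E) := measurable_prodMk_left hE
    have hout : (μ'.prod σ) ((f ⁻¹' {v})ᶜ ×ˢ (univ : Set S')) = 0 := by
      rw [Measure.prod_prod, hμ', Measure.smul_apply, Measure.restrict_apply (hf (measurableSet_singleton v)).compl,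
        compl_inter_self, measure_empty, smul_zero, zero_mul]
    have hsplit : {p : Ω × S' | (f p.1, p.2) ∈ E} ∩ ((f ⁻¹' {v}) ×ˢ univ) = (f ⁻¹' {v}) ×ˢ (Prod.mk v ⁻¹' E) := by
      ext ⟨a, s'⟩
      simp only [mem_inter_iff, mem_setOf_eq, mem_prod, mem_preimage, mem_singleton_iff, mem_univ, and_true]
      constructor
      · rintro ⟨h, ha⟩; exact ⟨ha, by rwa [ha] at h⟩
      · rintro ⟨ha, h⟩; exact ⟨by rwa [ha], ha⟩
    have hval : (μ'.prod σ) {p : Ω × S' | (f p.1, p.2) ∈ E} = (μ'.prod σ) ((f ⁻¹' {v}) ×ˢ (Prod.mk v ⁻¹' E)) := by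
      rw [← hsplit]
      refine le_antisymm ?_ (measure_mono inter_subset_left)
      calc (μ'.prod σ) {p : Ω × S' | (f p.1, p.2) ∈ E}
          ≤ (μ'.prod σ) (({p : Ω × S' | (f p.1, p.2) ∈ E} ∩ ((f ⁻¹' {v}) ×ˢ univ)) ∪ (f ⁻¹' {v})ᶜ ×ˢ univ) :=
            measure_mono fun p hp ↦ by
              by_cases h : f p.1 = v
              · exact Or.inl ⟨hp, mem_prod.2 ⟨h, mem_univ _⟩⟩
              · exact Or.inr (mem_prod.2 ⟨h, mem_univ _⟩)
        _ ≤ (μ'.prod σ) ({p : Ω × S' | (f p.1, p.2) ∈ E} ∩ ((f ⁻¹' {v}) ×ˢ univ)) + (μ'.prod σ) ((f ⁻¹' {v})ᶜ ×ˢ univ) :=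
            measure_union_le _ _
        _ = _ := by rw [hout, add_zero]
    rw [hval, Measure.prod_prod, hσ, snd_restrict_singleton_prod_apply v hEv, hμ', Measure.smul_apply,
      Measure.restrict_apply_self, smul_eq_mul]
    rcases eq_or_ne (μ (f ⁻¹' {v})) 0 with h0 | h0
    · have : π ({v} ×ˢ (Prod.mk v ⁻¹' E)) = 0 :=
        measure_mono_null (prod_mono Subset.rfl (subset_univ _)) (by rw [measure_singleton_prod_univ hf h1, h0])
      rw [this, mul_zero]
    · rw [ENNReal.inv_mul_cancel h0 (measure_ne_top _ _), one_mul]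
  rw [Finset.sum_congr rfl hterm]
  -- `Σ_{v ∈ F} π({v} × E_v) = π(E ∩ (F × S')) = π(E)`
  have hdisj : PairwiseDisjoint (↑F : Set S) fun v ↦ ({v} ×ˢ (Prod.mk v ⁻¹' E) : Set (S × S')) :=
    fun v _ v' _ hne ↦ disjoint_left.2 fun p hp hp' ↦ hne ((mem_prod.1 hp).1.symm.trans (mem_prod.1 hp').1)
  rw [← measure_biUnion_finset hdisj fun v _ ↦ (measurableSet_singleton v).prod (measurable_prodMk_left hE)]
  have hFc : π ((↑F : Set S)ᶜ ×ˢ (univ : Set S')) = 0 := by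
    rw [show ((↑F : Set S)ᶜ ×ˢ univ : Set (S × S')) = Prod.fst ⁻¹' (↑F : Set S)ᶜ by ext p; simp,
      ← Measure.map_apply measurable_fst F.measurableSet.compl, h1, Measure.map_apply hf F.measurableSet.compl]
    convert measure_empty (μ := μ)
    exact eq_empty_of_forall_notMem fun a ha ↦ ha (hF a)
  refine le_antisymm (measure_mono (iUnion₂_subset fun v _ p hp ↦ ?_)) ?_
  · obtain ⟨h1', h2'⟩ := mem_prod.1 hp
    rw [mem_singleton_iff] at h1'
    have : p = (v, p.2) := Prod.ext h1' rfl
    rw [this]; exact h2'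
  · calc π E ≤ π ((⋃ v ∈ F, {v} ×ˢ (Prod.mk v ⁻¹' E)) ∪ (↑F : Set S)ᶜ ×ˢ univ) := measure_mono fun p hp ↦ ?_
      _ ≤ π (⋃ v ∈ F, {v} ×ˢ (Prod.mk v ⁻¹' E)) + π ((↑F : Set S)ᶜ ×ˢ univ) := measure_union_le _ _
      _ = _ := by rw [hFc, add_zero]
    by_cases h : p.1 ∈ F
    · refine Or.inl (mem_iUnion₂.2 ⟨p.1, h, mem_prod.2 ⟨rfl, ?_⟩⟩)
      change (p.1, p.2) ∈ E
      exact hp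
    · exact Or.inr (mem_prod.2 ⟨h, mem_univ _⟩)

include hf hF h1 in
/-- Outer-measure form of `liftCoupling_apply_preimage`, for an arbitrary (possibly
non-measurable) set `E`: the lift gives `{(a, s') | (f a, s') ∈ E}` at most the (outer) `π`-measure
of `E` (both sides are infima over measurable supersets). This is the form needed when `S × S'`
carries the product of two Borel σ-algebras of non-separable spaces, where closed sets such as
`{edist ≥ η}` need not be product-measurable. [folklore] -/
theorem liftCoupling_apply_preimage_le (E : Set (S × S')) :
    liftCoupling μ f F π {p | (f p.1, p.2) ∈ E} ≤ π E := by
  rw [measure_eq_iInf (μ := π) E]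
  refine le_iInf₂ fun E' hEE' ↦ le_iInf fun hE' ↦ ?_
  rw [← liftCoupling_apply_preimage hf hF h1 hE']
  exact measure_mono fun p hp ↦ hEE' hp

/-- **Lifting a coupling along a finitely-valued random variable.** Let `f : Ω → S` be
measurable with finitely many values (singletons of `S` measurable) and `π` a coupling on
`S × S'` of the law of `f` under `μ` with some law `ν`. Then there is a coupling `T` of `μ` and
`ν` on `Ω × S'` under which `(f(a), s')` has the law `π`; in particular every exceptional event
keeps its probability: `T{(a, s') | (f a, s') ∈ E} = π(E)`. (Elementary: condition `μ` on the
finitely many fibres of `f`; no disintegration or standard Borel hypothesis is needed.) [folklore] -/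
theorem exists_coupling_lift_of_finite_range {μ : Measure Ω} [IsProbabilityMeasure μ] {f : Ω → S}
    (hf : Measurable f) (hfin : (Set.range f).Finite) {π : Measure (S × S')} [IsProbabilityMeasure π]
    (h1 : π.map Prod.fst = μ.map f) :
    ∃ T : Measure (Ω × S'), IsProbabilityMeasure T ∧ T.map Prod.fst = μ ∧ T.map Prod.snd = π.map Prod.snd ∧
      (∀ E : Set (S × S'), MeasurableSet E → T {p | (f p.1, p.2) ∈ E} = π E) ∧
      ∀ E : Set (S × S'), T {p | (f p.1, p.2) ∈ E} ≤ π E := by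
  have hF : ∀ a, f a ∈ hfin.toFinset := fun a ↦ hfin.mem_toFinset.2 (mem_range_self a)
  exact ⟨liftCoupling μ f hfin.toFinset π, isProbabilityMeasure_liftCoupling hf hF h1,
    map_fst_liftCoupling hf hF h1, map_snd_liftCoupling hf hF h1,
    fun E hE ↦ liftCoupling_apply_preimage hf hF h1 hE, fun E ↦ liftCoupling_apply_preimage_le hf hF h1 E⟩

end

end Literature.Probability.Distributions

end
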